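import Mathlib
import Summits.Ventures.PercRepro2.CoinTreeCore
import Summits.Ventures.PercRepro2.CoinOrTailKDefs
import Summits.Ventures.PercRepro2.CoinKSureMarkerBB2Coins

/-!
# The markers at two OR-vertices of the head: an instantiation (blind cell PercRepro2,
night-2 g16; NIGHT2-DARC.md §56.20)

A coin system on `Fin 12` (s = 0, m = 1, r₁ = 2, r₂ = 3, q₁ = 4, q₂ = 5, a = 6, b = 7, b′ = 8,
w = 9, h = 10, t = 11) with seventeen coins: the out-tree core `s → {m, r₁, r₂, q₁, q₂}`, the
OR-tail `a` entered from `r₁, r₂`, a second OR-vertex `b` entered from `q₁, q₂`, a THIRD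
OR-vertex `b′` entered from `m, q₂`, the head `a → t`, `b → t`, `w → t`, `b → w`, `b′ → h`,
`h → t`.  Row 2′DARC at `a → w` for the markers `(b′, b)` for EVERY probability vector, no
hypothesis (`darc_markerBB'_example_coins`).
-/

namespace Summit.Ventures.PercRepro2.Coin

namespace MarkerBB2Example

open Classical

/-- The seventeen coins of the example. -/
def arcsMBB : Fin 17 → Finset (Fin 12 × Fin 12)
  | 0 => {(0, 1)}   -- s → m
  | 1 => {(0, 2)}   -- s → r₁
  | 2 => {(0, 3)}   -- s → r₂
  | 3 => {(0, 4)}   -- s → q₁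
  | 4 => {(0, 5)}   -- s → q₂
  | 5 => {(2, 6)}   -- r₁ → a
  | 6 => {(3, 6)}   -- r₂ → a
  | 7 => {(4, 7)}   -- q₁ → b
  | 8 => {(5, 7)}   -- q₂ → b
  | 9 => {(1, 8)}   -- m → b′
  | 10 => {(5, 8)}  -- q₂ → b′
  | 11 => {(6, 11)} -- a → t
  | 12 => {(7, 11)} -- b → t
  | 13 => {(9, 11)} -- w → t
  | 14 => {(7, 9)}  -- b → w
  | 15 => {(8, 10)} -- b′ → h
  | 16 => {(10, 11)} -- h → t
  | _ => ∅

/-- The entry coins of `a`. -/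
def cMBB : Fin 12 → Fin 17
  | 2 => 5
  | 3 => 6
  | _ => 0

/-- The entry coins of `b`. -/
def dMBB : Fin 12 → Fin 17
  | 4 => 7
  | 5 => 8
  | _ => 0

/-- The entry coins of `b′`. -/
def d'MBB : Fin 12 → Fin 17
  | 1 => 9
  | 5 => 10
  | _ => 0

/-- The tree coins. -/
def tcMBB : Fin 12 → Fin 17
  | 1 => 0
  | 2 => 1
  | 3 => 2
  | 4 => 3
  | 5 => 4
  | _ => 0

/-- The parent map. -/
def parMBB : Fin 12 → Fin 12 := fun _ => 0

/-- The rank. -/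
def rkMBB : Fin 12 → ℕ
  | 1 => 1
  | 2 => 1
  | 3 => 1
  | 4 => 1
  | 5 => 1
  | _ => 0

/-- Every coin is a single arc. -/
lemma sameEnds_mbb : SameEnds arcsMBB := by
  intro e xy hxy x'y' hx'y'
  fin_cases e <;> simp [arcsMBB] at hxy hx'y' <;> subst hxy <;> subst hx'y' <;>
    exact ⟨Or.inl rfl, Or.inr rfl⟩

set_option maxRecDepth 20000 in
/-- The out-tree core. -/
lemma treeCore_mbb : TreeCore arcsMBB 0 {1, 2, 3, 4, 5} tcMBB parMBB rkMBB where
  tree := by decide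
  par_mem := by decide
  rank := by decide
  into_C := by decide
  into_s := by decide
  s_notin := by decide

set_option maxRecDepth 20000 in
/-- `a = 6` is an OR-tail of the core. -/
lemma orTailK_mbb : OrTailK arcsMBB 0 {1, 2, 3, 4, 5} {2, 3} cMBB 6 where
  ent_sub := by decide
  s_notin := by decide
  a_notin := by decide
  a_ne_s := by decide
  into_U := by decide
  into_s := by decide
  into_a := by decide
  arcs_c := by decide
  c_inj := by decide

set_option maxRecDepth 20000 in
/-- `b = 7` is an OR-tail of `U ∪ {a}`. -/
lemma orTailKb_mbb : OrTailK arcsMBB 0 (insert 6 {1, 2, 3, 4, 5}) {4, 5} dMBB 7 where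
  ent_sub := by decide
  s_notin := by decide
  a_notin := by decide
  a_ne_s := by decide
  into_U := by decide
  into_s := by decide
  into_a := by decide
  arcs_c := by decide
  c_inj := by decide

set_option maxRecDepth 20000 in
/-- `b′ = 8` is an OR-tail of `U ∪ {a, b}`. -/
lemma orTailKb'_mbb : OrTailK arcsMBB 0 (insert 7 (insert 6 {1, 2, 3, 4, 5})) {1, 5} d'MBB 8 where
  ent_sub := by decide
  s_notin := by decide
  a_notin := by decide
  a_ne_s := by decide
  into_U := by decide
  into_s := by decide
  into_a := by decide
  arcs_c := by decide
  c_inj := by decide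

/-- **Row 2′DARC at `a → w` for the markers `(b′, b)` on the seventeen-coin instance, every
probability vector — no hypothesis.** -/
theorem darc_markerBB'_example_coins {R : Type*} [Field R] [LinearOrder R]
    [IsStrictOrderedRing R] (pr : Fin 17 → R) (hp : IsProbVec pr) :
    DARC pr arcsMBB 0 {11} 8 7 6 9 :=
  darc_of_orTailTreeK_markerBB'_coins pr hp sameEnds_mbb orTailK_mbb orTailKb_mbb (by decide)
    orTailKb'_mbb (by decide) (by decide) treeCore_mbb (by decide) (by decide) (by decide)
    (by decide)

end MarkerBB2Example

end Summit.Ventures.PercRepro2.Coin
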